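/-
Width seat `ym-line-cbag-p1-w3` (prover-ym-line-cbag-p1-w3-g8-0), the only seat left on LINE 3 `route-QuantumFields-SixPlaneColdBox`:
REGISTERED STUB 1 `stub_sixPlaneTransferWithSlackG : SixPlaneTransferWithSlackG` of the birth skeleton of crux `DensityTransferG`
(stmt-QuantumFields-25709), BY NAME, from the landed content `sixPlaneTransferWithSlack_of_torusMeanNear`.
-/
import Summits.QuantumFields.YangMills.Theorems.SixPlaneColdBoxDensityTransferGDefs
import Summits.QuantumFields.YangMills.Theorems.SixPlaneColdBoxTransferWithSlack

/-!
# Crux `DensityTransferG` (stmt-QuantumFields-25709), stub 1: `stub_sixPlaneTransferWithSlackG`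

`SixPlaneTransferWithSlackG` (the skeleton's stub 1, `Theorems/SixPlaneColdBoxDensityTransferGDefs.lean`) is literally
`TorusMeanNearColdBoxG → (∀ G r, ∃ A θ η m …, η·β²·Cov_box − β^{−(8A+m)} ≤ β²·⟨F;F⟩_torus eventually)`, and
`sixPlaneTransferWithSlack_of_torusMeanNear` (`Theorems/SixPlaneColdBoxTransferWithSlack.lean`: the six-plane DLR transfer with slack —
sharp one-scale kernel mean/covariance expansions with datum for all 36 plane pairs, flat-box comparison, large-field rarity on the collar,
law of total covariance with the datum floor, torus means through the box kernels, exponent budget) has exactly that type.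

No sorry; standard axioms.  NOT the Yang–Mills mass gap: a step of a LINE onto the RECORD-type node `LatticeNonFreezing`, conditional (as
the crux is) on the open crux `TorusMeanNearColdBoxG`.
-/

set_option autoImplicit false

namespace Summit.QuantumFields.YangMills.Theorems.SixPlaneColdBox

/-- **Registered stub 1 of crux `DensityTransferG`: the six-plane DLR transfer with slack, given the torus-mean bound.** -/
theorem stub_sixPlaneTransferWithSlackG : SixPlaneTransferWithSlackG :=
  fun h => sixPlaneTransferWithSlack_of_torusMeanNear h

end Summit.QuantumFields.YangMills.Theorems.SixPlaneColdBox
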